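import Summits.BirchSwinnertonDyer.BirchSwinnertonDyer.Theorems.EisensteinPrimesHidaLimitFittingBound

/-!
# STUB-IDEAS k3 (gen 14) for `stub_heegnerIndexLowerAtTwo` — typed sketch (no `sorry`, no new facts, BSD is NOT proved by any of this)

Technique: DECOMPOSITION (split into sub-stubs with a provable glue).  The v12 skeleton of record of the parent
(`Cruxes/SplitBadTwoRankOneOfFacts/Lines/rubin_value_two_lead_v12(_1).lean`, PICKED addenda 12–13) inserted a NEW research stub
S3d `stub_strictDefectAtVbar_two` (the seam between Agboola's STRICT-above-`v̄` dual `X^{str}` — valued by the S3c THEOREM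
`SelmerLocImage.restrictedControl_two_holds` — and the UNRAMIFIED Greenberg–Vatsal datum `X^{unr}` that the two-variable push (SP)∘(RES)
reaches).  This sketch splits S3d, FOR THE LOWER CHILD ONLY, into
* SEAM⁻ (inclusion half, PROVABLE NOW: §B) `n ≤ n' ≤ n + E(k)` — from `𝔖 ≤ S` (tree `LineTransport.restrictedSelmerZp_le_datumSelmer`),
  multiplicativity of `char` (tree `Module.charIdeal_eq_mul_of_exact`) and `char(finite) = ⊤` (tree `charIdeal_eq_top_of_finite`);
* SEAM⁺ (surjectivity / exactness half, research) — needed by LOWER only at the ANCHOR and only on keys with INFINITE receptacle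
  (`E(k) > 0`, i.e. the single key `(1,3)`, tree `LineTransport.fixedPoints_decomp_vbar_inf_kerSubgroup_eq_top_of_frame`),
and proves the ℤ-level glue (§A): `A ≤ B + (E(k) − ι₀)`; hence `A ≤ B` outright on the five keys with `E(k) = 0`.
-/

set_option linter.dupNamespace false
set_option autoImplicit false

namespace Summit.BirchSwinnertonDyer.BirchSwinnertonDyer.Cruxes.SplitBadTwoLowerHalfOfFacts.StubIdeasK3G14

/-! ## §A  ℤ-shadow of the decomposition (the provable glue)

Currency (critic `StubPlanT3ArmMPrimeS3cExact.lean`, LEAD v12): at a member `W` of key `k`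
`A = v₂ Ш_an(W)`, `B = v₂ #Ш(W)[2^∞]`, `g = v₂ Tam − 2 v₂ #tors + 2ℓ` (common S2′/S3c bookkeeping), `m` = valuation of the two-variable
value (S2′: `m = 2(A+g) + e_A(k)`), `n'` = `HasCharValuationAt` of the UNRAMIFIED datum (T1⁻ containment + push: `m ≤ 2 n' + e_M(k)`),
`n` = `HasCharValuationAt` of Agboola's STRICT datum (S3c theorem: `n = B + g + e_C(k)`), seam `n ≤ n' ≤ n + E` (SEAM⁻, §B) with
`E = E(k) := v₂ (char (Loc_{v̄}^∨)(0))`; at the anchor `W₀` (same key) the Euler-system direction `2 n'₀ + e_M ≤ m₀`, the exact seam digit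
`n'₀ = n₀ + ι₀` (`0 ≤ ι₀ ≤ E`) and LOWER-anchor `A₀ ≤ B₀`. -/

/-- **GLUE.** LOWER at every member, up to the one-sided seam slack `E(k) − ι₀` of its key. -/
theorem lower_of_seam {A B m n n' g eA eM eC E A₀ B₀ m₀ n₀ n'₀ g₀ ι₀ : ℤ}
    (hS2 : m = 2 * (A + g) + eA) (hT1 : m ≤ 2 * n' + eM)
    (_hSeamLo : n ≤ n') (hSeamHi : n' ≤ n + E) (hS3c : n = B + g + eC)
    (hS2₀ : m₀ = 2 * (A₀ + g₀) + eA) (hES₀ : 2 * n'₀ + eM ≤ m₀)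
    (hSeam₀ : n'₀ = n₀ + ι₀) (hS3c₀ : n₀ = B₀ + g₀ + eC) (hLow₀ : A₀ ≤ B₀) :
    A ≤ B + (E - ι₀) := by
  omega

/-- **Five keys for free.** If the receptacle `H¹_nr((K*_∞)_𝔓, W*)` is FINITE on the key (`E(k) = 0`: keys `(1,7),(0,1),(0,3),(0,5),(0,7)`),
the seam is invisible: LOWER holds with NO input from S3d⁺. -/
theorem lower_of_seam_finiteReceptacle {A B m n n' g eA eM eC E A₀ B₀ m₀ n₀ n'₀ g₀ ι₀ : ℤ}
    (hS2 : m = 2 * (A + g) + eA) (hT1 : m ≤ 2 * n' + eM)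
    (_hSeamLo : n ≤ n') (hSeamHi : n' ≤ n + E) (hS3c : n = B + g + eC)
    (hS2₀ : m₀ = 2 * (A₀ + g₀) + eA) (hES₀ : 2 * n'₀ + eM ≤ m₀)
    (hSeam₀ : n'₀ = n₀ + ι₀) (hS3c₀ : n₀ = B₀ + g₀ + eC) (hLow₀ : A₀ ≤ B₀)
    (hE : E = 0) (hι₀ : 0 ≤ ι₀) : A ≤ B := by
  omega

/-- **Key `(1,3)`, variant (i): surjectivity AT THE ANCHOR ONLY** (`ι₀ = E`): LOWER at every member of the key. -/
theorem lower_of_seam_surjectiveAnchor {A B m n n' g eA eM eC E A₀ B₀ m₀ n₀ n'₀ g₀ ι₀ : ℤ}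
    (hS2 : m = 2 * (A + g) + eA) (hT1 : m ≤ 2 * n' + eM)
    (_hSeamLo : n ≤ n') (hSeamHi : n' ≤ n + E) (hS3c : n = B + g + eC)
    (hS2₀ : m₀ = 2 * (A₀ + g₀) + eA) (hES₀ : 2 * n'₀ + eM ≤ m₀)
    (hSeam₀ : n'₀ = n₀ + ι₀) (hS3c₀ : n₀ = B₀ + g₀ + eC) (hLow₀ : A₀ ≤ B₀)
    (hsurj₀ : ι₀ = E) : A ≤ B := by
  omega

/-- **Key `(1,3)`, variant (ii): IMAGE MONOTONICITY member → anchor** (`ι_W ≤ ι₀`, one-sided; no exactness anywhere). -/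
theorem lower_of_seam_monotone {A B m n n' g eA eM eC ι A₀ B₀ m₀ n₀ n'₀ g₀ ι₀ : ℤ}
    (hS2 : m = 2 * (A + g) + eA) (hT1 : m ≤ 2 * n' + eM)
    (hSeam : n' = n + ι) (hS3c : n = B + g + eC)
    (hS2₀ : m₀ = 2 * (A₀ + g₀) + eA) (hES₀ : 2 * n'₀ + eM ≤ m₀)
    (hSeam₀ : n'₀ = n₀ + ι₀) (hS3c₀ : n₀ = B₀ + g₀ + eC) (hLow₀ : A₀ ≤ B₀)
    (hmono : ι ≤ ι₀) : A ≤ B := by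
  omega

/-- **Key `(1,3)`, variant (iii): CROSS-KEY anchor on a finite-receptacle key `k₀`** (`n'₀ = n₀` there) with the arm-M″ one-sided floors
`e_A(k₀) ≤ e_A(k)`, `e_M(k) ≤ e_M(k₀)` and the quantitative THRESHOLD `ι + e_C(k) ≤ e_C(k₀)` (the S3c table difference absorbs the seam). -/
theorem lower_of_seam_crossKey {A B m n n' g eA eM eC ι A₀ B₀ m₀ n₀ n'₀ g₀ eA₀ eM₀ eC₀ : ℤ}
    (hS2 : m = 2 * (A + g) + eA) (hT1 : m ≤ 2 * n' + eM)
    (hSeam : n' = n + ι) (hS3c : n = B + g + eC)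
    (hS2₀ : m₀ = 2 * (A₀ + g₀) + eA₀) (hES₀ : 2 * n'₀ + eM₀ ≤ m₀)
    (hSeam₀ : n'₀ = n₀) (hS3c₀ : n₀ = B₀ + g₀ + eC₀) (hLow₀ : A₀ ≤ B₀)
    (hflA : eA₀ ≤ eA) (hceilM : eM ≤ eM₀) (hthr : ι + eC ≤ eC₀) : A ≤ B := by
  omega

/-- **SHARPNESS: S3d⁺ is load-bearing exactly at an infinite-receptacle anchor.** All hypotheses of `lower_of_seam` are consistent with
`E = 2`, `ι₀ = 0` (anchor image finite), member seam digit `2` (member image full) and `A = B + 2`: without monotonicity / anchor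
surjectivity the LOWER conclusion fails on such a key, and ONLY there. -/
theorem seam_slack_is_sharp :
    ∃ A B m n n' g eA eM eC E A₀ B₀ m₀ n₀ n'₀ g₀ ι₀ : ℤ,
      m = 2 * (A + g) + eA ∧ m ≤ 2 * n' + eM ∧ n ≤ n' ∧ n' ≤ n + E ∧ n = B + g + eC ∧
      m₀ = 2 * (A₀ + g₀) + eA ∧ 2 * n'₀ + eM ≤ m₀ ∧ n'₀ = n₀ + ι₀ ∧ n₀ = B₀ + g₀ + eC ∧ A₀ ≤ B₀ ∧
      E = 2 ∧ ι₀ = 0 ∧ A = B + 2 :=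
  ⟨2, 0, 4, 0, 2, 0, 0, 0, 0, 2, 0, 0, 0, 0, 0, 0, 0, by omega⟩

/-- **PREDICTION (cheapest falsifier of the whole picture).** If the PARENT's two-sided laws hold at BSD₂-anchors of two keys `k`, `k₀`
(`ι` = seam digit of `k`, `0` on `k₀`) and the digits `e_A`, `e_M` agree across the pair (k3-g9 local type / k3-g13 PLAN C), then the S3c
table difference EQUALS the seam digit: `e_C(k₀) − e_C(k) = ι`.  For the δ-pair `k = (1,3)`, `k₀ = (1,7)` this predicts
`e_C(1,7) − e_C(1,3) ∈ {0, 2}` and `= 2` iff the Greenberg–Vatsal surjectivity holds on `(1,3)` — readable off the constructive S3c witnesses. -/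
theorem tableDiff_eq_seam_of_exactLaws {A₁ B₁ g₁ m₁ n₁ n'₁ eA eM eC ι A₀ B₀ g₀ m₀ n₀ n'₀ eA₀ eM₀ eC₀ : ℤ}
    (hS2₁ : m₁ = 2 * (A₁ + g₁) + eA) (hMC₁ : m₁ = 2 * n'₁ + eM) (hSeam₁ : n'₁ = n₁ + ι)
    (hS3c₁ : n₁ = B₁ + g₁ + eC) (hBSD₁ : A₁ = B₁)
    (hS2₀ : m₀ = 2 * (A₀ + g₀) + eA₀) (hMC₀ : m₀ = 2 * n'₀ + eM₀) (hSeam₀ : n'₀ = n₀)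
    (hS3c₀ : n₀ = B₀ + g₀ + eC₀) (hBSD₀ : A₀ = B₀)
    (hA : eA = eA₀) (hM : eM = eM₀) : eC₀ - eC = ι := by
  omega

/-! ## §B  Module shadow of SEAM⁻ (PROVED from tree algebra; generic Noetherian domain, then `Λ = ℤ_p⟦T⟧`)

Frame instantiation (prose; typing is helper H-S1 of the card): `Xstr := D_A.X` (Agboola `RestrictedDualData κ' W* v̄ γ'`, valued by S3c),
`Xunr := D_nr.X` (`DatumDualData κ₂ γ₂ W* (bdpData W* 2 v̄) ∅`), `g := ` Pontryagin dual of the inclusion `𝔖_{v̄}(K*_∞, W*) ≤ S_{W*}(K*_∞)`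
(`LineTransport.restrictedSelmerZp_le_datumSelmer`, so `g` is onto), `ker g = (S/𝔖)^∨`, `L := Loc_{v̄}^∨ = H¹_nr((K*_∞)_𝔓, W*)^∨` with
`S/𝔖 ↪ Loc_{v̄}` (the defects at `w ∤ 2` vanish over the line: `Gal(K_w^{nr}/(K*_∞)_w)` is pro-odd), so `L ↠ ker g`. -/

section Generic

variable {R : Type*} [CommRing R]

/-- Ideal-level sandwich: `(H') = I·(H)` and `(f) ≤ I` give `H ∣ H'` and `H' ∣ f·H`. -/
theorem seam_dvd_sandwich {I : Ideal R} {f H H' : R}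
    (hH' : Ideal.span {H'} = I * Ideal.span {H}) (hf : Ideal.span {f} ≤ I) :
    H ∣ H' ∧ H' ∣ f * H := by
  constructor
  · have h : Ideal.span {H'} ≤ Ideal.span {H} := hH' ▸ Ideal.mul_le_left
    exact Ideal.span_singleton_le_span_singleton.mp h
  · have h : Ideal.span {f * H} ≤ Ideal.span {H'} := by
      rw [← Ideal.span_singleton_mul_span_singleton, hH']
      exact Ideal.mul_mono_left hf
    exact Ideal.span_singleton_le_span_singleton.mp h

open Literature.NumberTheory.EllipticCurves in
/-- **SEAM⁻ (structural form).** Over a Noetherian domain: a surjection `g : Xunr ↠ Xstr` of f.g. torsion modules whose kernel is a quotient of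
a torsion module `L` with `char L = (f)`; if `char Xstr = (H)` and `char Xunr = (H')` then `H ∣ H' ∣ f·H`.  Inputs: multiplicativity of `char`
in short exact sequences (tree `Module.charIdeal_eq_mul_of_exact`) twice. -/
theorem seam_of_charIdeal [IsNoetherianRing R] [IsDomain R]
    {Xunr Xstr L : Type*} [AddCommGroup Xunr] [Module R Xunr] [AddCommGroup Xstr] [Module R Xstr]
    [AddCommGroup L] [Module R L] [Module.Finite R Xunr] [Module.Finite R L]
    (hXtor : Module.IsTorsion R Xunr) (hLtor : Module.IsTorsion R L)
    (g : Xunr →ₗ[R] Xstr) (hg : Function.Surjective g)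
    (π : L →ₗ[R] LinearMap.ker g) (hπ : Function.Surjective π)
    {f H H' : R} (hL : Module.charIdeal R L = Ideal.span {f})
    (hstr : Module.charIdeal R Xstr = Ideal.span {H}) (hunr : Module.charIdeal R Xunr = Ideal.span {H'}) :
    H ∣ H' ∧ H' ∣ f * H := by
  have h1 : Module.charIdeal R Xunr = Module.charIdeal R (LinearMap.ker g) * Module.charIdeal R Xstr :=
    Module.charIdeal_eq_mul_of_exact hXtor (LinearMap.ker g).subtype g Subtype.val_injective hg
      (LinearMap.exact_subtype_ker_map g)
  have h2 : Module.charIdeal R L = Module.charIdeal R (LinearMap.ker π) * Module.charIdeal R (LinearMap.ker g) :=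
    Module.charIdeal_eq_mul_of_exact hLtor (LinearMap.ker π).subtype π Subtype.val_injective hπ
      (LinearMap.exact_subtype_ker_map π)
  refine seam_dvd_sandwich (I := Module.charIdeal R (LinearMap.ker g)) ?_ ?_
  · rw [← hunr, ← hstr, h1]
  · rw [← hL, h2]
    exact Ideal.mul_le_left

end Generic

section Iwasawa

variable {p : ℕ} [Fact p.Prime]

/-- Divisibility of power series bounds the `p`-adic valuation of constant coefficients (when the larger one is nonzero). -/
theorem valuation_constantCoeff_le_of_dvd {a b : PowerSeries ℤ_[p]} (h : a ∣ b)
    (hb : PowerSeries.constantCoeff b ≠ 0) :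
    (PowerSeries.constantCoeff a).valuation ≤ (PowerSeries.constantCoeff b).valuation := by
  obtain ⟨c, rfl⟩ := h
  rw [map_mul] at hb ⊢
  obtain ⟨ha, hc⟩ := mul_ne_zero_iff.mp hb
  rw [PadicInt.valuation_mul ha hc]
  exact Nat.le_add_right _ _

/-- **SEAM⁻ (valuation form): `n ≤ n' ≤ n + E`.** From `H ∣ H' ∣ f·H` with `H'(0) ≠ 0`, `f(0)·H(0) ≠ 0`:
`v(H(0)) ≤ v(H'(0)) ≤ v(f(0)) + v(H(0))` — the digits `n = v(H(0))` (strict, S3c), `n' = v(H'(0))` (unramified, the push's target),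
`E = v(f(0))` (the receptacle's characteristic value). -/
theorem seam_valuation_sandwich {f H H' : PowerSeries ℤ_[p]} (h1 : H ∣ H') (h2 : H' ∣ f * H)
    (hH' : PowerSeries.constantCoeff H' ≠ 0) (hf : PowerSeries.constantCoeff f ≠ 0)
    (hH : PowerSeries.constantCoeff H ≠ 0) :
    (PowerSeries.constantCoeff H).valuation ≤ (PowerSeries.constantCoeff H').valuation ∧
      (PowerSeries.constantCoeff H').valuation ≤
        (PowerSeries.constantCoeff f).valuation + (PowerSeries.constantCoeff H).valuation := by
  refine ⟨valuation_constantCoeff_le_of_dvd h1 hH', ?_⟩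
  have hfH : PowerSeries.constantCoeff (f * H) ≠ 0 := by
    rw [map_mul]; exact mul_ne_zero hf hH
  have := valuation_constantCoeff_le_of_dvd h2 hfH
  rwa [map_mul, PadicInt.valuation_mul hf hH] at this

open Literature.NumberTheory.EllipticCurves in
/-- **`ι = 0` on a finite receptacle (the five keys `≠ (1,3)`).** If the defect `ker g = (S/𝔖)^∨` is FINITE (automatic when the receptacle
`Loc_{v̄}` is finite: `(W*)^{D_{v̄} ⊓ ker κ'}`-type groups of order `≤ 2` off key `(1,3)`), then `char Xunr = char Xstr` EXACTLY — S3d holds on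
that key with `e_δ = 0`, for members and anchors alike (tree `charIdeal_eq_top_of_finite`). -/
theorem charIdeal_unr_eq_str_of_finite_defect
    {Xunr Xstr : Type*} [AddCommGroup Xunr] [Module (IwasawaAlgebra p) Xunr] [AddCommGroup Xstr]
    [Module (IwasawaAlgebra p) Xstr] [Module.Finite (IwasawaAlgebra p) Xunr]
    (hXtor : Module.IsTorsion (IwasawaAlgebra p) Xunr)
    (g : Xunr →ₗ[IwasawaAlgebra p] Xstr) (hg : Function.Surjective g) [Finite (LinearMap.ker g)] :
    Module.charIdeal (IwasawaAlgebra p) Xunr = Module.charIdeal (IwasawaAlgebra p) Xstr := by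
  rw [Module.charIdeal_eq_mul_of_exact hXtor (LinearMap.ker g).subtype g Subtype.val_injective hg
      (LinearMap.exact_subtype_ker_map g),
    Summit.BirchSwinnertonDyer.BirchSwinnertonDyer.Theorems.charIdeal_eq_top_of_finite, Ideal.top_mul]

/-- Hence equal digits on a finite-receptacle key: `(H') = (H)` forces `v(H'(0)) = v(H(0))` (both nonzero). -/
theorem valuation_eq_of_span_eq {H H' : PowerSeries ℤ_[p]} (h : Ideal.span {H'} = Ideal.span {H})
    (hH' : PowerSeries.constantCoeff H' ≠ 0) (hH : PowerSeries.constantCoeff H ≠ 0) :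
    (PowerSeries.constantCoeff H').valuation = (PowerSeries.constantCoeff H).valuation :=
  le_antisymm
    (valuation_constantCoeff_le_of_dvd (Ideal.span_singleton_le_span_singleton.mp h.ge) hH)
    (valuation_constantCoeff_le_of_dvd (Ideal.span_singleton_le_span_singleton.mp h.le) hH')

end Iwasawa

/-! ## §C  Helper SIGNATURES for the research halves (statements only; `Prop`-valued, no `sorry`)

Abstract shapes; the frame-level typings (over `Agboola2007.RestrictedDualData` / `GreenbergVatsal2000.DatumDualData` of the LEAD's v12
frame) are the card's helper lemmas H-S1 … H-S5. -/

section Signatures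

variable (R : Type*) [CommRing R]

/-- H-S4 shape — **S3d⁺ at ONE curve (the anchor):** the defect is the WHOLE receptacle, `ker g ≃ L` (Greenberg–Vatsal Prop. 2.1-type
surjectivity of `S_{W*₀}(K*_∞) → H¹_nr((K*_∞)_𝔓, W*₀)` for the single anchor curve `W₀` of key `(1,3)`). -/
def SurjectiveAtAnchor {Xunr Xstr L : Type*} [AddCommGroup Xunr] [Module R Xunr] [AddCommGroup Xstr] [Module R Xstr]
    [AddCommGroup L] [Module R L] (g : Xunr →ₗ[R] Xstr) : Prop :=
  Nonempty (L ≃ₗ[R] LinearMap.ker g)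

/-- H-S3 shape — **image monotonicity member → anchor on key `(1,3)`:** the member's defect is a SUBQUOTIENT-bounded by the anchor's:
`char (ker g₀) ≤ char (ker g_W)` (ideal containment = divisibility the right way: `ι_W ≤ ι₀`). -/
def DefectMonotone {X₁ Y₁ X₀ Y₀ : Type*} [AddCommGroup X₁] [Module R X₁] [AddCommGroup Y₁] [Module R Y₁]
    [AddCommGroup X₀] [Module R X₀] [AddCommGroup Y₀] [Module R Y₀]
    (gW : X₁ →ₗ[R] Y₁) (g₀ : X₀ →ₗ[R] Y₀) : Prop :=
  Literature.NumberTheory.EllipticCurves.Module.charIdeal R (LinearMap.ker g₀) ≤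
    Literature.NumberTheory.EllipticCurves.Module.charIdeal R (LinearMap.ker gW)

end Signatures

end Summit.BirchSwinnertonDyer.BirchSwinnertonDyer.Cruxes.SplitBadTwoLowerHalfOfFacts.StubIdeasK3G14
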